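import Literature.NumberTheory.LFunctions.KMVCutoffWMellin
import Literature.NumberTheory.LFunctions.KMVHeckeRecursionExactAFE
import Literature.NumberTheory.LFunctions.KMVCentralValueSquaredAFEProofs
import Mathlib.Analysis.Normed.Module.FiniteDimension
import HarnessLib

/-!
# The bridge `afeW q̂ 0 0 n₁ n₂ = W(n₁n₂/q̂²)`: the `k = 0` row of KMV's typed exact formula (22)
# (`KMV2000.kmv2000_eq22`) IS the closed-form statement `KMV2000.completedL_half_sq_eq`

Source: E. Kowalski, P. Michel, J. VanderKam, J. reine angew. Math. 526 (2000), (21)–(22) p. 12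
[held: paper:doi-10-1515-crll-2000-074]. Cell landau-siegel / ls-inputs, row H-AFE (INPUT LIST
v1.4.1 G2-2, item (B) «the MANDATORY bridge `afeW (qhat q) 0 0 n₁ n₂ = cutoffW (n₁n₂/q̂²)` so the
typed fact's k = 0 case follows in one line — dedup»), seat ls-inputs-Hafe-w1 g0. Proofs only.

The tree types (22) for all orders `k` with the Mellin–Barnes weight
`KMV2000.afeW q̂ i j n₁ n₂ = (1/2π) ∫_ℝ D_i(q̂;n₁,t) D_j(q̂;n₂,t) t⁻¹ dv` (`t = 3 + iv`,
`D_0(q̂;n,t) = q̂ᵗ Γ(1+t) n^{−t}`, `KMVHeckeRecursionExactAFE`), and separately the `k = 0` statement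
`KMV2000.completedL_half_sq_eq` over the closed real form `W = KMV2000.cutoffW`
(`KMVCentralValueSquaredAFE`). Here:

* `KMV2000.afeKernel_zero_mul_div`: on `t ≠ 0`,
  `D_0(q̂;n₁,t) D_0(q̂;n₂,t)/t = (n₁n₂/q̂²)^{−t} Γ(t) Γ(1+t)` (`Γ(1+t) = tΓ(t)`, positive real bases).
* `KMV2000.afeW_zero_zero_eq_cutoffW`: **`afeW q̂ 0 0 n₁ n₂ = W(n₁n₂/q̂²)`** for `q̂ > 0`, `n₁n₂ ≥ 1`
  — by the Mellin inversion `W(y) = (1/2πi)∫_{(3)} Γ(t)Γ(1+t) y^{−t} dt` of `KMVCutoffWMellin`.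
* `KMV2000.afeTerm_zero_zero_eq_afeSqTerm`: the summands agree on all of `ℕ × ℕ`
  (both vanish on the axes), and `KMV2000.derivLambda_zero`: `Λ^{(0)}(f,½) = Λ(f,½)`.
* `KMV2000.completedL_half_sq_eq_of_kmv2000_eq22` and
  `KMV2000.kmv2000_eq22_zero_of_completedL_half_sq_eq`: the `k = 0` row of `kmv2000_eq22` and
  `completedL_half_sq_eq` are the same statement (norm-summability ⇔ summability in `ℂ`).

No claim about Landau–Siegel zeros; nothing here proves (22) itself.
-/

noncomputable section

open scoped Real
open Complex Set MeasureTheory CongruenceSubgroup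
open Literature.NumberTheory.EllipticCurves.ModularForms

namespace Literature.NumberTheory.LFunctions.KMV2000

/-! ### Pointwise identification of the Mellin–Barnes integrands at order `0` -/

/-- `D_0(q̂; n, s) = q̂ˢ Γ(1+s) n^{−s}` (the `0`-th derivative is the kernel itself).
[cite: KowalskiMichelVanderKam2000, (13) p. 9 and (22) p. 12] -/
theorem afeKernel_zero (qh : ℝ) (n : ℕ) (s : ℂ) :
    afeKernel qh 0 n s = (qh : ℂ) ^ s * Complex.Gamma (1 + s) * (n : ℂ) ^ (-s) := by
  simp [afeKernel]

/-- A positive real base: `aʷ = exp(w log a)` with the REAL logarithm. [folklore] -/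
private lemma ofReal_cpow_eq_exp {a : ℝ} (ha : 0 < a) (w : ℂ) :
    (a : ℂ) ^ w = Complex.exp ((Real.log a : ℂ) * w) := by
  rw [Complex.cpow_def_of_ne_zero (ofReal_ne_zero.mpr ha.ne'), Complex.ofReal_log ha.le]

/-- Positive real bases recombine: `q̂ᵗ a^{−t} · q̂ᵗ b^{−t} = (ab/q̂²)^{−t}`.
[cite: KowalskiMichelVanderKam2000, (21)–(22) p. 12] -/
theorem cpow_mul_cpow_neg_mul_eq {qh a b : ℝ} (hqh : 0 < qh) (ha : 0 < a) (hb : 0 < b) (t : ℂ) :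
    (qh : ℂ) ^ t * (a : ℂ) ^ (-t) * ((qh : ℂ) ^ t * (b : ℂ) ^ (-t)) =
      ((a * b / qh ^ 2 : ℝ) : ℂ) ^ (-t) := by
  have hx : 0 < a * b / qh ^ 2 := by positivity
  rw [ofReal_cpow_eq_exp hqh, ofReal_cpow_eq_exp ha, ofReal_cpow_eq_exp hb, ofReal_cpow_eq_exp hx,
    ← Complex.exp_add, ← Complex.exp_add, ← Complex.exp_add]
  congr 1
  rw [Real.log_div (mul_pos ha hb).ne' (pow_pos hqh 2).ne', Real.log_mul ha.ne' hb.ne',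
    Real.log_pow]
  push_cast
  ring

/-- **The order-`0` Mellin–Barnes integrand**: for `t ≠ 0`, `q̂ > 0`, `n₁, n₂ ≥ 1`,
`D_0(q̂;n₁,t) D_0(q̂;n₂,t) / t = (n₁n₂/q̂²)^{−t} · Γ(t) Γ(t+1)` (`Γ(1+t) = t Γ(t)`), i.e. the printed
kernel `Γ(1+t)² (q̂²/n₁n₂)ᵗ / t` of (21)–(22) at `k = 0`. [cite: KowalskiMichelVanderKam2000, (21)–(22) p. 12] -/
theorem afeKernel_zero_mul_div {qh : ℝ} (hqh : 0 < qh) {n₁ n₂ : ℕ} (hn₁ : n₁ ≠ 0) (hn₂ : n₂ ≠ 0)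
    {t : ℂ} (ht : t ≠ 0) :
    afeKernel qh 0 n₁ t * afeKernel qh 0 n₂ t / t =
      (((n₁ : ℝ) * n₂ / qh ^ 2 : ℝ) : ℂ) ^ (-t) * (Complex.Gamma t * Complex.Gamma (t + 1)) := by
  have h₁ : (0 : ℝ) < n₁ := by exact_mod_cast Nat.pos_of_ne_zero hn₁
  have h₂ : (0 : ℝ) < n₂ := by exact_mod_cast Nat.pos_of_ne_zero hn₂
  rw [afeKernel_zero, afeKernel_zero, add_comm (1 : ℂ) t, Complex.Gamma_add_one t ht,
    ← cpow_mul_cpow_neg_mul_eq hqh h₁ h₂ t]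
  push_cast
  field_simp

/-! ### The bridge -/

/-- **`afeW q̂ 0 0 n₁ n₂ = W(n₁n₂/q̂²)`** for `q̂ > 0` and `n₁, n₂ ≥ 1`: the order-`0` Mellin–Barnes
weight of the typed (22) is KMV's cut-off `W` (21) in the tree's closed real form `cutoffW`, by
Mellin inversion on `Re t = 3` (`cutoffW_eq_integral_vertical`).
[cite: KowalskiMichelVanderKam2000, (21)–(22) p. 12] -/
theorem afeW_zero_zero_eq_cutoffW {qh : ℝ} (hqh : 0 < qh) {n₁ n₂ : ℕ} (hn₁ : n₁ ≠ 0) (hn₂ : n₂ ≠ 0) :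
    afeW qh 0 0 n₁ n₂ = ((cutoffW ((n₁ : ℝ) * n₂ / qh ^ 2) : ℝ) : ℂ) := by
  have h₁ : (0 : ℝ) < n₁ := by exact_mod_cast Nat.pos_of_ne_zero hn₁
  have h₂ : (0 : ℝ) < n₂ := by exact_mod_cast Nat.pos_of_ne_zero hn₂
  have hx : 0 < (n₁ : ℝ) * n₂ / qh ^ 2 := by positivity
  have h3 := cutoffW_eq_integral_vertical (σ := 3) (by norm_num) hx
  have hcast : ((3 : ℝ) : ℂ) = (3 : ℂ) := by norm_num
  rw [hcast] at h3
  rw [h3, afeW]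
  congr 1
  refine integral_congr_ae (ae_of_all _ fun v ↦ ?_)
  have ht : (3 : ℂ) + v * I ≠ 0 := by
    intro h
    have := congrArg Complex.re h
    simp at this
  simp only
  rw [afeKernel_zero_mul_div hqh hn₁ hn₂ ht]

/-- `q̂ = √q / 2π > 0` for `q ≥ 1`. [cite: KowalskiMichelVanderKam2000, §1 p. 1 (q̂ = √q/2π)] -/
theorem qhat_pos_of_neZero (q : ℕ) [NeZero q] : 0 < qhat q := by
  rw [qhat]
  exact div_pos (Real.sqrt_pos.mpr (by exact_mod_cast NeZero.pos q)) (by positivity)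

/-- **The summands agree**: `afeTerm q f 0 0 n₁ n₂ = afeSqTerm q f (n₁, n₂)` on all of `ℕ × ℕ`
(both are `0` when `n₁ n₂ = 0`; otherwise the bridge `afeW q̂ 0 0 n₁ n₂ = W(n₁n₂/q̂²)`).
[cite: KowalskiMichelVanderKam2000, (21)–(22) p. 12] -/
theorem afeTerm_zero_zero_eq_afeSqTerm (q : ℕ) [NeZero q] (f : CuspForm (Gamma0 q) 2) (n₁ n₂ : ℕ) :
    afeTerm q f 0 0 n₁ n₂ = afeSqTerm q f (n₁, n₂) := by
  by_cases h : n₁ = 0 ∨ n₂ = 0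
  · rw [afeTerm, if_pos h]
    rcases h with h | h
    · rw [h, afeSqTerm_of_fst_eq_zero]
    · rw [h, afeSqTerm_of_snd_eq_zero]
  · have h' := not_or.mp h
    rw [afeTerm, if_neg h, afeW_zero_zero_eq_cutoffW (qhat_pos_of_neZero q) h'.1 h'.2, afeSqTerm]

/-- The same on `ℕ × ℕ`: `afeTerm q f 0 0 n.1 n.2 = afeSqTerm q f n`.
[cite: KowalskiMichelVanderKam2000, (21)–(22) p. 12] -/
theorem afeTerm_zero_zero_eq_afeSqTerm' (q : ℕ) [NeZero q] (f : CuspForm (Gamma0 q) 2) (n : ℕ × ℕ) :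
    afeTerm q f 0 0 n.1 n.2 = afeSqTerm q f n :=
  afeTerm_zero_zero_eq_afeSqTerm q f n.1 n.2

/-- `Λ^{(0)}(f, ½) = Λ(f, ½)`. [cite: KowalskiMichelVanderKam2000, (2) p. 1] -/
theorem derivLambda_zero (q : ℕ) [NeZero q] (f : CuspForm (Gamma0 q) 2) :
    derivLambda q 0 f = completedL q f (1 / 2) := by
  simp [derivLambda]

/-! ### The `k = 0` row of (22) and the closed-form statement are the same -/

/-- **The typed all-order (22) gives the closed-form `k = 0` statement**:
`kmv2000_eq22 → completedL_half_sq_eq` (row `k = 0`, bridge, `Λ^{(0)} = Λ`; norm-summable ⇒ summable).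
[cite: KowalskiMichelVanderKam2000, (21)–(22) p. 12] -/
theorem completedL_half_sq_eq_of_kmv2000_eq22 (h : kmv2000_eq22) : completedL_half_sq_eq := by
  intro q _ hq f hf
  obtain ⟨hsum, heq⟩ := h q hq f hf 0
  simp_rw [afeTerm_zero_zero_eq_afeSqTerm'] at hsum heq
  rw [derivLambda_zero] at heq
  exact ⟨summable_norm_iff.mp hsum, heq⟩

/-- **Conversely, the closed-form statement is the `k = 0` row of the typed (22), verbatim**
(summable ⇒ norm-summable in the finite-dimensional space `ℂ`).
[cite: KowalskiMichelVanderKam2000, (21)–(22) p. 12] -/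
theorem kmv2000_eq22_zero_of_completedL_half_sq_eq (h : completedL_half_sq_eq) :
    ∀ (q : ℕ) [NeZero q], q.Prime → ∀ f ∈ newforms0 q 2,
      Summable (fun n : ℕ × ℕ ↦ ‖afeTerm q f 0 0 n.1 n.2‖) ∧
        derivLambda q 0 f ^ 2 = 2 * (qhat q : ℂ) * ∑' n : ℕ × ℕ, afeTerm q f 0 0 n.1 n.2 := by
  intro q _ hq f hf
  obtain ⟨hsum, heq⟩ := h q hq f hf
  simp_rw [afeTerm_zero_zero_eq_afeSqTerm', derivLambda_zero]
  exact ⟨summable_norm_iff.mpr hsum, heq⟩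

/-- **The `k = 0` row of KMV's typed (22) is a theorem** (appended once H-AFE was discharged):
for `q` prime and `f ∈ S₂(q)^*`, `Σ_{ℕ×ℕ} ‖afeTerm q f 0 0 n₁ n₂‖ < ∞` and
`Λ^{(0)}(f,½)² = 2 q̂ Σ'_{ℕ×ℕ} afeTerm q f 0 0 n₁ n₂` — the lead's `completedL_half_sq_eq_holds`
(`KMVCentralValueSquaredAFEProofs`, real-variable Fricke split) transported through the bridge.
Orders `k ≥ 1` of `kmv2000_eq22` remain typed, not proved. [cite: KowalskiMichelVanderKam2000, (21)–(22) p. 12] -/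
theorem kmv2000_eq22_zero_holds :
    ∀ (q : ℕ) [NeZero q], q.Prime → ∀ f ∈ newforms0 q 2,
      Summable (fun n : ℕ × ℕ ↦ ‖afeTerm q f 0 0 n.1 n.2‖) ∧
        derivLambda q 0 f ^ 2 = 2 * (qhat q : ℂ) * ∑' n : ℕ × ℕ, afeTerm q f 0 0 n.1 n.2 :=
  kmv2000_eq22_zero_of_completedL_half_sq_eq completedL_half_sq_eq_holds

end Literature.NumberTheory.LFunctions.KMV2000

end
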